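import Summits.KontsevichZagierPeriods.KontsevichZagierPeriods.Theorems.LiftingCriteriaCubeNashNormalFormHalfCell

/-!
# `CubeNashNormalForm` (stmt-KontsevichZagierPeriods-3574), `k ≤ 1`: one-dimensional
# representations on an interval are cube–Nash combinations

Support file for the item `CubeNashNormalForm` of route `LiftingCriteria`. For every subgroup
`N ≤ FormalRep` containing the relations and the cube–Nash generators, every one-dimensional
representation `r` with domain `{z | z 0 ∈ (a, b)}`, `a < b` real algebraic, lies in `N`
(`of_mem_of_Ioo`): the integrand is real analytic off finitely many ALGEBRAIC break points
(`CurvePeriodsTransfer.stub_saPieceFacts`, route SymplecticScissors); cut `r` into the cells of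
these points (rule 1a, `ArcSymbols.exists_cells`), cut each cell at its algebraic mid-point and send
the two halves to cube–Nash generators by the ramified charts of
`CubeNashNormalFormHalfCell.of_cut_mem`. [Kontsevich–Zagier 2001, §1.2 rules (1), (2)]
-/

noncomputable section

open Set MeasureTheory Filter Topology
open Literature.ModelTheory.ExponentialFields (IsSemialgebraic)
open Literature.NumberTheory.Transcendental
open Literature.NumberTheory.Transcendental.KZ
open Summit.KontsevichZagierPeriods.SymplecticScissors.RealOnePeriodRelations.ArcSymbols
open Summit.KontsevichZagierPeriods.SymplecticScissors.CurvePeriodsTransfer (stub_saPieceFacts)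
open Summit.KontsevichZagierPeriods.LiftingCriteria.CubeNashNormalFormHalfCell (of_cut_mem)

namespace Summit.KontsevichZagierPeriods.LiftingCriteria.CubeNashNormalFormCells

/-- `closure (1a ∪ 2) ≤ relations`. [folklore] -/
theorem closure_dom_cov_le_relations :
    AddSubgroup.closure (domainAddRel ∪ changeOfVariablesRel) ≤ relations :=
  (AddSubgroup.closure_le _).mpr (Set.union_subset domainAddRel_subset_relations
    changeOfVariablesRel_subset_relations)

/-- Half of an algebraic number is algebraic (used for mid-points and half-lengths). [folklore] -/
theorem isAlgebraic_div_two {x : ℝ} (hx : IsAlgebraic ℚ x) : IsAlgebraic ℚ (x / 2) := by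
  have h2a : IsAlgebraic ℚ (2 : ℝ) := by exact_mod_cast isAlgebraic_nat 2
  rw [div_eq_mul_inv]
  exact hx.mul h2a.inv

/-- **One-dimensional representations on an algebraic interval are cube–Nash combinations.**
See the module docstring. [cite: KontsevichZagier2001, §1.2 rules (1)-(2)] -/
theorem of_mem_of_Ioo (N : AddSubgroup FormalRep) (hrel : relations ≤ N)
    (hgen : ∀ {m : ℕ} (t : IntegralRep m) (g : (Fin m → ℝ) → ℝ) (U : Set (Fin m → ℝ)),
      IsOpen U → Set.pi Set.univ (fun _ : Fin m => Set.Icc (0:ℝ) 1) ⊆ U →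
      IsSemialgebraicFunOn ℚ U g → AnalyticOnNhd ℝ g U →
      t.domain = Set.pi Set.univ (fun _ : Fin m => Set.Icc (0:ℝ) 1) →
      (∀ z ∈ Set.pi Set.univ (fun _ : Fin m => Set.Icc (0:ℝ) 1), t.integrand z = g z) → of t ∈ N)
    (r : IntegralRep 1) {a b : ℝ} (hab : a < b) (ha : IsAlgebraic ℚ a) (hb : IsAlgebraic ℚ b)
    (hdom : r.domain = {z : Fin 1 → ℝ | z 0 ∈ Ioo a b}) : of r ∈ N := by
  classical
  set f : ℝ → ℝ := fun t => r.integrand fun _ => t with hf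
  have hfz : ∀ z : Fin 1 → ℝ, r.integrand z = f (z 0) := fun z => by
    rw [hf]
    exact congrArg r.integrand (funext fun i => by rw [Fin.fin_one_eq_zero i])
  have hsa : IsSemialgebraicFunOn ℚ {z : Fin 1 → ℝ | z 0 ∈ Ioo a b} (fun z => f (z 0)) := by
    have h1 := r.isSemialgebraicFunOn_integrand
    rw [hdom] at h1
    exact h1.congr fun z _ => hfz z
  -- break points and cells
  obtain ⟨B, hBsub, hBalg, hcells⟩ := stub_saPieceFacts.2 f a b hab hsa
  obtain ⟨cells, hcellsP, hsum⟩ :=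
    exists_cells r B hBalg a b ha hb hab (fun e he => hBsub (Finset.mem_coe.2 he))
  have hcl := closure_dom_cov_le_relations
  have e0 : of r - of (cut r a b) ∈ relations := hcl (of_sub_of_cut_mem r ha hb hdom)
  have e1 : of (cut r a b) - ∑ c ∈ cells, of (cut r c.1 c.2) ∈ relations := hcl hsum
  -- each cell
  have hcell : ∀ c ∈ cells, of (cut r c.1 c.2) ∈ N := by
    intro c hc
    obtain ⟨h1, h2, h3, h4, h5, h6, h7, h8⟩ := hcellsP c hc
    obtain ⟨P, -, hP⟩ := hcells c.1 c.2 h2 h6 h7 h8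
    have han : ∀ x ∈ Ioo c.1 c.2, AnalyticAt ℝ (fun t => r.integrand fun _ => t) x :=
      fun x hx => (hP x hx).1
    have hIoo : Ioo c.1 c.2 ⊆ Ioo a b := Ioo_subset_Ioo h1 h3
    have hL : 0 < (c.2 - c.1) / 2 := by linarith
    have hLa : IsAlgebraic ℚ ((c.2 - c.1) / 2) := isAlgebraic_div_two (h5.sub h4)
    have he : IsAlgebraic ℚ ((c.1 + c.2) / 2) := isAlgebraic_div_two (h4.add h5)
    have hsplit : of (cut r c.1 c.2) - of (cut r c.1 ((c.1 + c.2) / 2)) -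
        of (cut r ((c.1 + c.2) / 2) c.2) ∈ relations :=
      hcl (cut_split r h4 he h5 (by linarith) (by linarith))
    -- left half: `x = c.1 + L t`
    have hleft : of (cut r c.1 ((c.1 + c.2) / 2)) ∈ N := by
      refine of_cut_mem N hrel hgen r hdom hIoo han c.1 ((c.2 - c.1) / 2) 1 h4 hL hLa (Or.inl rfl)
        (fun t ht => ⟨by nlinarith [ht.1], by nlinarith [ht.2]⟩) c.1 ((c.1 + c.2) / 2) h4 he
        (Ioo_subset_Ioo le_rfl (by linarith)) ?_
      rw [affine_image_Ioo_pos c.1 _ hL]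
      congr 1
      ring
    -- right half: `x = c.2 - L t`
    have hright : of (cut r ((c.1 + c.2) / 2) c.2) ∈ N := by
      refine of_cut_mem N hrel hgen r hdom hIoo han c.2 ((c.2 - c.1) / 2) (-1) h5 hL hLa (Or.inr rfl)
        (fun t ht => ⟨by nlinarith [ht.2], by nlinarith [ht.1]⟩) ((c.1 + c.2) / 2) c.2 he h5
        (Ioo_subset_Ioo (by linarith) le_rfl) ?_
      rw [affine_image_Ioo_neg c.2 _ hL]
      congr 1
      ring
    have : of (cut r c.1 c.2) = (of (cut r c.1 c.2) - of (cut r c.1 ((c.1 + c.2) / 2)) -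
        of (cut r ((c.1 + c.2) / 2) c.2)) + of (cut r c.1 ((c.1 + c.2) / 2)) +
        of (cut r ((c.1 + c.2) / 2) c.2) := by abel
    rw [this]
    exact N.add_mem (N.add_mem (hrel hsplit) hleft) hright
  have hsumN : ∑ c ∈ cells, of (cut r c.1 c.2) ∈ N := N.sum_mem fun c hc => hcell c hc
  have : of r = (of r - of (cut r a b)) + (of (cut r a b) - ∑ c ∈ cells, of (cut r c.1 c.2)) +
      ∑ c ∈ cells, of (cut r c.1 c.2) := by abel
  rw [this]
  exact N.add_mem (N.add_mem (hrel e0) (hrel e1)) hsumN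

end Summit.KontsevichZagierPeriods.LiftingCriteria.CubeNashNormalFormCells
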